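import Summits.CriticalPhenomena.SAWScalingLimit.Theses.SAWWeldingIdentification
import Summits.CriticalPhenomena.SAWScalingLimit.Theses.SAWLoopFugacityFlow
import Summits.CriticalPhenomena.SAWScalingLimit.Theorems.SAWWeldingIdentificationRemovableLimitOfSLELaw
import Summits.CriticalPhenomena.SAWScalingLimit.Theorems.SAWWeldingIdentificationRemovableLimitS1IsSimpleSubseqLimits
import Summits.CriticalPhenomena.SAWScalingLimit.Theorems.SAWWeldingIdentificationRemovableLimitUpToKappa
import Summits.CriticalPhenomena.SAWScalingLimit.Theorems.SAWWeldingIdentificationRemovableLimitSLEFourTransfer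
import Literature.Probability.RandomPlanarGeometry.SLEFourRemovability
import HarnessLib

/-!
# Crux `RemovableLimit` (stmt-CriticalPhenomena-4503) — line `birth` / `registered`, skeleton v5.2

Route `SAWWeldingIdentification` (sub-problem `SAWScalingLimit`), crux (R) `RemovableLimit`: for
every conformal rectangle `Q` (Dobrushin domain `Q.chord 0 2 = (Ω; a, b)`, `Ω = Q.carrier`,
`a = Q.pt 0`, `b = Q.pt 2`), every endpoint approximation `(a_δ, b_δ)` and every probability
measure `P` on `CurveClass ℂ` that is a weak limit of the pushed-forward critical SAW laws along
some `δ_n → 0⁺`, `P`-almost every curve is a SIMPLE CHORD of `(Ω; a, b)` that is CONFORMALLY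
REMOVABLE inside `Ω` (the clause inlined in the crux is `IsConformallyRemovableIn.self_maps`).

## The line, v5 (lead c12): identification UP TO κ ∧ simplicity ∧ Kavvadias–Miller–Schoug

Skeleton v4 (lead c11) proved (R) ⟸ S0a ∧ S1 with S0a = "every subsequential SAW limit is a
chordal SLE_κ law for SOME `κ > 0`, `κ ≠ 4`" and S1 = `SimpleSubseqLimits` (stmt-4982), the pin
`κ ≤ 4` being FORCED by S1 (T4 `stub_kappaPin`, LANDED p160927) and removability of simple-phase
SLE laws with `κ < 4` being PROVED (Rohde–Schramm Thm 5.2 + Jones–Smirnov, p151121). The clause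
`κ ≠ 4` was an artefact standing in for the removability of SLE₄. Lead c12 observed that
Kavvadias–Miller–Schoug (arXiv:2209.10532) prove their Theorem 1.1 THROUGH their Theorem 8.1,
whose conclusion ("`f : D → ℂ` a homeomorphism onto its image, conformal on `D ∖ X` ⇒ conformal on
`D`", `D = ℍ`, `X` = range of the SLE₄ trace) is verbatim the tree's `IsConformallyRemovableIn`, so
the in-domain removability of SLE₄ IS in print. Skeleton v5 therefore trades the clause for a
NAMED PUBLISHED FACT:

* **S0b `stub_someSLELaw`** (open) — every subsequential weak limit `P` of the critical SAW laws
  in `(Q; a_δ, b_δ)` is a chordal SLE_κ law in `Q.chord 0 2` for SOME `κ > 0` (NO side condition).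
  "Identification up to the value of `κ`" = conformal invariance + domain Markov of subsequential
  limits; literally implied by the registered DOCK STUB `stub_identificationUpToKappa` of the
  stmt-0783 chain (`Theorems.RemovableLimit.someSLELaw_of_identificationUpToKappa`, p160927), by the
  v4 stub S0a, by stmt-0783, by stmt-4502 (W) and by the summit. Research-open (LSW 2004 §3.4.2).
* **S1 `stub_simpleSubseqLimits`** (open) — VERBATIM the sibling crux
  `SAWLoopFugacityFlow.SimpleSubseqLimits` (stmt-CriticalPhenomena-4982, own live chain): every
  subsequential weak limit is carried by simple chords. Necessary for (R)
  (`simpleSubseqLimits_of_removableLimit`, p143725).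
* **T3 `stub_sleFourTraceRemovable`** (open, LITERATURE STUB) — the Kavvadias–Miller–Schoug
  theorem in `ℍ`-form: a.s. the range of the SLE₄ trace is conformally removable inside `ℍ`
  (`IsConformallyRemovableIn ℍ (range (sleTrace 4 ω))`). = VERBATIM (`Iff.rfl`,
  `sleFourTraceRemovable_iff_kms`) the named fact
  `Literature.Probability.RandomPlanarGeometry.KavvadiasMillerSchoug2022_thm11` LANDED by lead c12
  (p164970, `Literature/Probability/RandomPlanarGeometry/SLEFourRemovability.lean`); NOT a research
  target of this line — the standing worker reply is
  `stub-blocked: KavvadiasMillerSchoug2022_thm11` until a literature-prover DISCHARGES the fact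
  (`theorem KavvadiasMillerSchoug2022_thm11_holds`, 78 pp. of GFF level-line estimates + KMS Thm 8.1).
* **T5 `stub_sleFourDomainTransfer`** (LANDED by lead c12, p164908,
  `Theorems/SAWWeldingIdentificationRemovableLimitSLEFourTransfer.lean`; discharged below by the tree theorem of
  the same name) — the transfer T3 ⟹ "every chordal SLE₄ random curve in a Dobrushin domain has a.s. conformally
  removable trace inside the domain" (conformal invariance of removability along the chordal
  uniformiser, `IsConformallyRemovableIn.image_conformalEquiv`, + RS05 Thm 6.1 simplicity of the trace;
  the "arbitrary simply connected domain" remark after KMS Thm 1.1). Its conclusion is the hypothesis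
  `h3` of the tree composition `removableLimit_of_someSLELaw_of_simpleSubseqLimits_of_sleFourRemovable`.
* **T4 `stub_kappaPin`** (LANDED p160927, discharged below by the tree theorem of the same name) —
  an SLE_κ law charging simple curve classes has `κ ≤ 4`.
* **Glue, PROVED** (tree, p160927 + p164908): with S1 (simple chords, κ-pin `κ ≤ 4`), S0b
  (`IsSLELaw κ (Q.chord 0 2) P`, `κ > 0`) and the landed transfers (`κ < 4`: RS05 5.2 + JS; `κ = 4`:
  T5(T3) through the analytic bad set, `ae_isConformallyRemovableIn_of_isSLELaw_four`) the tree
  composition `removableLimit_of_someSLELaw_of_simpleSubseqLimits_of_trace` (p164908) concludes the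
  ROUTE DECL by name in `RemovableLimit_of`, modulo exactly S0b, S1, T3.

Kernel-exact position of (R) after v5 (all arrows tree theorems + this file):
`summit ⟹ stmt-0783 ⟺ stmt-4502 ⟹ S0(κ = 8/3) ⟹ S0a ⟹ S0b ⟸ [0783 dock stub]`,
`stmt-0783 ⟹ (R) ⟹ stmt-4982 = S1`, **`T3 ∧ T5 ∧ S0b ∧ S1 ⟹ (R)`** (T5 proved), and (v4, still valid)
`S0a ∧ S1 ⟹ (R)` without T3.

## Audit shape

`sorry` occurs exactly in the three OPEN registered stubs `stub_someSLELaw` (S0b, research),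
`stub_simpleSubseqLimits` (S1 = stmt-4982, research) and `stub_sleFourTraceRemovable` (T3 = KMS 2022
Thm 1.1, literature); the registered stubs `stub_kappaPin` (T4, p160927) and
`stub_sleFourDomainTransfer` (T5, p164908) have LANDED and are discharged by the tree theorems of the
same names; `*_holds` certify that the stub texts are the named statements; `RemovableLimit_of`
takes the statements under their registered names (`Registered.stub_*`) and concludes
`Summit.CriticalPhenomena.SAWScalingLimit.Theses.SAWWeldingIdentification.RemovableLimit` by name.

## Disproof used

No `Disproof.lean` / `Theorems/RemovableLimit/Negative/*` exists for this crux (2026-08-17T14:00Z).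
S0b and S1 keep every hypothesis of the crux verbatim (so the sibling obstructions
`subseqIdentification_false_without_fstLimit/sndLimit/oneSided/meshToZero` of
`Cruxes/SubseqIdentification/Disproof.lean` are honoured); T3 is a published theorem; T4 is sharp by
RS05 Thm 6.1 (`ae_mem_simple_iff_le_four`).

## References

Kavvadias–Miller–Schoug, *Conformal removability of SLE₄*, arXiv:2209.10532 v1 (2022), Thm 1.1
(p. 3), Thm 8.1 (p. 62), proof of Thm 1.1 (p. 61) [`KavvadiasMillerSchoug2022`]; [RohdeSchramm2005]
§1 p. 885–886, Thm 5.2, Thm 6.1; [JonesSmirnov2000] Def. 1, Cor. 2; [LawlerSchrammWerner2004SAW]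
§3.4.2; [Lawler2005] §6.3.
-/

noncomputable section

open MeasureTheory Filter Set Metric
open scoped Topology NNReal unitInterval
open UpperHalfPlane (upperHalfPlaneSet isOpen_upperHalfPlaneSet)
open Literature.Probability.RandomPlanarGeometry Literature.Probability.LatticeModels
open Literature.Probability.Process (preWienerMeasure)
open Summit.CriticalPhenomena.SAWScalingLimit.Theses.SAWWeldingIdentification (RemovableLimit
  WeldingLawOfLimit)
open Summit.CriticalPhenomena.SAWScalingLimit.Theses.SAWLoopFugacityFlow (SubseqIdentification
  SimpleSubseqLimits)

namespace Summit.CriticalPhenomena.SAWScalingLimit.Cruxes.RemovableLimit.Birth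

/-! ### Vocabulary of the line (local names; the stubs below unfold them by hand) -/

/-- `γ` is a **simple chord** of the Dobrushin domain `(Q.carrier; Q.pt 0, Q.pt 2)`: simple, from
`Q.pt 0` to `Q.pt 2`, inside the closed domain, meeting the frontier only at its endpoints — the
first conjunct of the crux, verbatim. -/
def IsSimpleChord (Q : ConformalRectangle) (γ : CurveClass ℂ) : Prop :=
  γ ∈ CurveClass.simple ∧ γ.source = Q.pt 0 ∧ γ.target = Q.pt 2 ∧ γ.range ⊆ closure Q.carrier ∧
    γ.range ∩ frontier Q.carrier ⊆ {Q.pt 0, Q.pt 2}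

/-- **S0b as a named statement**: every subsequential weak limit `P` of the critical SAW laws in
`(Q; a_δ, b_δ)` is a chordal SLE_κ law in `(Q.carrier; Q.pt 0, Q.pt 2)` for SOME `κ > 0`
(hypotheses = those of the crux, verbatim; no side condition on `κ`). -/
def SomeSLELaw : Prop :=
  ∀ (Q : ConformalRectangle) (a b : ℝ → Site 2), SAW.IsEndpointApprox (Q.chord 0 2 (by decide)) a b →
    ∀ (P : Measure (CurveClass ℂ)), IsProbabilityMeasure P → ∀ (δs : ℕ → ℝ), (∀ n, 0 < δs n) →
    Tendsto δs atTop (𝓝 0) →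
    (∀ f : BoundedContinuousFunction (CurveClass ℂ) ℝ,
      Tendsto (fun n => ∫ γ, f γ.curve ∂(SAW.law Q.carrier (δs n) (a (δs n)) (b (δs n)))) atTop
        (𝓝 (∫ γ, f γ ∂P))) →
    ∃ κ : ℝ≥0, 0 < κ ∧ IsSLELaw κ (Q.chord 0 2 (by decide)) P

/-- **The v4 stub S0a as a named statement** (kept for the record: it implies S0b): as S0b with
the side condition `κ ≠ 4`. -/
def SLESubseqLimitUpToKappa : Prop :=
  ∀ (Q : ConformalRectangle) (a b : ℝ → Site 2), SAW.IsEndpointApprox (Q.chord 0 2 (by decide)) a b →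
    ∀ (P : Measure (CurveClass ℂ)), IsProbabilityMeasure P → ∀ (δs : ℕ → ℝ), (∀ n, 0 < δs n) →
    Tendsto δs atTop (𝓝 0) →
    (∀ f : BoundedContinuousFunction (CurveClass ℂ) ℝ,
      Tendsto (fun n => ∫ γ, f γ.curve ∂(SAW.law Q.carrier (δs n) (a (δs n)) (b (δs n)))) atTop
        (𝓝 (∫ γ, f γ ∂P))) →
    ∃ κ : ℝ≥0, 0 < κ ∧ κ ≠ 4 ∧ IsSLELaw κ (Q.chord 0 2 (by decide)) P

/-- **The v3 stub S0 as a named statement** (kept for the record: it implies S0a and S0b): every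
subsequential weak limit is THE chordal SLE₈/₃ law. ≡ stmt-0783 framed on `Q.chord 0 2`. -/
def SLESubseqLimit : Prop :=
  ∀ (Q : ConformalRectangle) (a b : ℝ → Site 2), SAW.IsEndpointApprox (Q.chord 0 2 (by decide)) a b →
    ∀ (P : Measure (CurveClass ℂ)), IsProbabilityMeasure P → ∀ (δs : ℕ → ℝ), (∀ n, 0 < δs n) →
    Tendsto δs atTop (𝓝 0) →
    (∀ f : BoundedContinuousFunction (CurveClass ℂ) ℝ,
      Tendsto (fun n => ∫ γ, f γ.curve ∂(SAW.law Q.carrier (δs n) (a (δs n)) (b (δs n)))) atTop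
        (𝓝 (∫ γ, f γ ∂P))) →
    IsSLELaw ((8 : ℝ≥0) / 3) (Q.chord 0 2 (by decide)) P

/-- **T3 as a named statement**: the Kavvadias–Miller–Schoug theorem in `ℍ`-form — almost surely
the range of the SLE₄ trace is conformally removable inside `ℍ` (= the Literature named fact
`KavvadiasMillerSchoug2022_thm11`, p164970, verbatim: `sleFourTraceRemovable_iff_kms`). -/
def SLEFourTraceRemovable : Prop :=
  ∀ᵐ ω ∂preWienerMeasure, IsConformallyRemovableIn upperHalfPlaneSet (range (sleTrace 4 ω))

/-- **T3 IS the Literature named fact** (definitional equality, checked by `Iff.rfl`). -/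
theorem sleFourTraceRemovable_iff_kms :
    SLEFourTraceRemovable ↔ Literature.Probability.RandomPlanarGeometry.KavvadiasMillerSchoug2022_thm11 :=
  Iff.rfl

/-- **T5 as a named statement**: the transfer — IF the SLE₄ trace is a.s. removable inside `ℍ`
(T3), THEN every chordal SLE₄ random curve in a Dobrushin domain has a.s. conformally removable
trace inside the domain. -/
def SLEFourDomainTransfer : Prop :=
  (∀ᵐ ω ∂preWienerMeasure, IsConformallyRemovableIn upperHalfPlaneSet (range (sleTrace 4 ω))) →
    ∀ (D : DobrushinDomain) (Γ : (ℝ≥0 → ℝ) → CurveClass ℂ), IsSLECurve 4 D Γ →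
    ∀ᵐ ω ∂preWienerMeasure, IsConformallyRemovableIn D.carrier (Γ ω).range

/-- **T4 as a named statement**: a chordal SLE_κ law in a Dobrushin domain that is carried by
simple curve classes has `κ ≤ 4`. -/
def KappaPin : Prop :=
  ∀ (κ : ℝ≥0) (D : DobrushinDomain) (μ : Measure (CurveClass ℂ)), IsSLELaw κ D μ →
    (∀ᵐ γ ∂μ, γ ∈ CurveClass.simple) → κ ≤ 4

/-! ### The stubs (the ONLY `sorry`s of the file), over tree vocabulary only -/

/-- **S0b (stub) — every subsequential SAW limit is a chordal SLE_κ law for some `κ > 0`.**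
For every conformal rectangle `Q`, endpoint approximation `(a_δ, b_δ)` of `(Q.pt 0, Q.pt 2)` and
probability measure `P` that is the weak limit of the pushed-forward critical SAW laws of
`(Q.carrier; a_δ, b_δ)` along some `δ_n > 0`, `δ_n → 0`: there is `κ > 0` such that `P` is a
chordal SLE_κ law in `Q.chord 0 2`. Identification of the limit UP TO THE VALUE OF `κ` (conformal
invariance + domain Markov property of the limit; the LSW 2004 §3.4.2 standing hypothesis), with NO
side condition on `κ`; implied verbatim by the stmt-0783 dock stub `stub_identificationUpToKappa`
(`Theorems.RemovableLimit.someSLELaw_of_identificationUpToKappa`), by the v4 stub S0a, by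
stmt-0783 / stmt-4502 / the summit. Open (research). -/
theorem stub_someSLELaw :
    ∀ (Q : ConformalRectangle) (a b : ℝ → Site 2), SAW.IsEndpointApprox (Q.chord 0 2 (by decide)) a b →
    ∀ (P : Measure (CurveClass ℂ)), IsProbabilityMeasure P → ∀ (δs : ℕ → ℝ), (∀ n, 0 < δs n) →
    Tendsto δs atTop (𝓝 0) →
    (∀ f : BoundedContinuousFunction (CurveClass ℂ) ℝ,
      Tendsto (fun n => ∫ γ, f γ.curve ∂(SAW.law Q.carrier (δs n) (a (δs n)) (b (δs n)))) atTop
        (𝓝 (∫ γ, f γ ∂P))) →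
    ∃ κ : ℝ≥0, 0 < κ ∧ IsSLELaw κ (Q.chord 0 2 (by decide)) P := by
  sorry

/-- **S1 (stub) — subsequential SAW limits are carried by simple chords**: VERBATIM the sibling
crux `SAWLoopFugacityFlow.SimpleSubseqLimits` (stmt-CriticalPhenomena-4982, which has its own line
chain; not re-attacked here): for every Dobrushin domain `D`, endpoint approximation and
subsequential weak limit `ν` of the critical SAW laws along `s_n → 0⁺`, `ν`-a.e. curve class is
simple, runs from `D.pt 0` to `D.pt 1` inside `closure D.carrier` and meets `frontier D.carrier`
only at the two marked points. Necessary for the crux (`simpleSubseqLimits_of_removableLimit`).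
Open (verdict open-problem at stmt-4982: the δ-uniform past/future avoidance estimate). -/
theorem stub_simpleSubseqLimits : SimpleSubseqLimits := by
  sorry

/-- **T3 (stub, LITERATURE) — Kavvadias–Miller–Schoug: the SLE₄ trace is a.s. conformally
removable inside `ℍ`.** For the trace `η = sleTrace 4 ω` of chordal SLE₄ in `ℍ` from `0` to `∞`,
almost surely every map continuous and injective on `ℍ` (a homeomorphism onto its image) and
holomorphic on `ℍ ∖ η[0, ∞)` is holomorphic on `ℍ` (`IsConformallyRemovableIn ℍ (range η)`).
Kavvadias–Miller–Schoug, arXiv:2209.10532, Thm 1.1 (p. 3) as established by its proof (p. 61)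
through Thm 8.1 (p. 62, conclusion "`f : D → ℂ` homeomorphism onto its image, conformal on
`D ∖ X` ⇒ conformal on `D`"). = the Literature named fact `KavvadiasMillerSchoug2022_thm11` (p164970,
`stub_sleFourTraceRemovable_of_kms` below); NOT a research target of this line: standing reply
`stub-blocked: KavvadiasMillerSchoug2022_thm11` (discharging it = `KavvadiasMillerSchoug2022_thm11_holds`).
[cite: KavvadiasMillerSchoug2022, Thm 1.1 via Thm 8.1] -/
theorem stub_sleFourTraceRemovable :
    ∀ᵐ ω ∂preWienerMeasure, IsConformallyRemovableIn upperHalfPlaneSet (range (sleTrace 4 ω)) := by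
  sorry

/-- **T5 (stub, LANDED p164908) — the domain transfer for SLE₄ removability.** If almost
surely the range of the SLE₄ trace is conformally removable inside `ℍ`, then for every Dobrushin
domain `D` and every chordal SLE₄ random curve `Γ` in `D` (`IsSLECurve 4 D Γ`), almost surely the
trace `(Γ ω).range` is conformally removable inside `D.carrier`. Proof (c12,
`Theorems/SAWWeldingIdentificationRemovableLimitSLEFourTransfer.lean`): inside `IsSLECurve` the curve
is a.s. the time-compactified image of the trace under the boundary extension of a chordal
uniformiser `φ : ℍ → D`; the trace is a.s. simple (RS05 Thm 6.1), so the part of the compactified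
curve inside the open carrier is `φ(η(0, ∞)) ⊆ φ(range η ∩ ℍ)`, removable by conformal invariance
(`IsConformallyRemovableIn.image_conformalEquiv`) and antitonicity. [folklore] -/
theorem stub_sleFourDomainTransfer :
    (∀ᵐ ω ∂preWienerMeasure, IsConformallyRemovableIn upperHalfPlaneSet (range (sleTrace 4 ω))) →
    ∀ (D : DobrushinDomain) (Γ : (ℝ≥0 → ℝ) → CurveClass ℂ), IsSLECurve 4 D Γ →
    ∀ᵐ ω ∂preWienerMeasure, IsConformallyRemovableIn D.carrier (Γ ω).range :=
  -- LANDED: p164908, Theorems/SAWWeldingIdentificationRemovableLimitSLEFourTransfer.lean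
  Theorems.RemovableLimit.stub_sleFourDomainTransfer

/-- **T4 (stub) — the `κ`-pin: an SLE_κ law charging simple curves has `κ ≤ 4`.** If `μ` is a
chordal SLE_κ law in the Dobrushin domain `D` (`IsSLELaw κ D μ`) and `μ`-almost every curve class
is simple (`CurveClass.simple`), then `κ ≤ 4`. LANDED (p160927): for `κ > 4` the SLE_κ trace is
a.s. not injective (`ae_not_injective_sleTrace_of_four_lt`, RS05 §1 p. 885 / Schramm 2000),
whereas a.s. simplicity of the class of its compactified image makes that image flat and hence the
trace injective; contradiction on a probability space. [cite: RohdeSchramm2005, §1 p. 885–886] -/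
theorem stub_kappaPin :
    ∀ (κ : ℝ≥0) (D : DobrushinDomain) (μ : Measure (CurveClass ℂ)), IsSLELaw κ D μ →
    (∀ᵐ γ ∂μ, γ ∈ CurveClass.simple) → κ ≤ 4 :=
  -- LANDED: p160927, Theorems/SAWWeldingIdentificationRemovableLimitUpToKappa.lean
  Theorems.RemovableLimit.stub_kappaPin

/-- **T3 from the Literature named fact** (the discharge route of the literature stub: a proof
`KavvadiasMillerSchoug2022_thm11_holds` closes T3 by this term). -/
theorem stub_sleFourTraceRemovable_of_kms
    (h : Literature.Probability.RandomPlanarGeometry.KavvadiasMillerSchoug2022_thm11) :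
    ∀ᵐ ω ∂preWienerMeasure, IsConformallyRemovableIn upperHalfPlaneSet (range (sleTrace 4 ω)) :=
  h

/-! ### Consistency: each unfolded stub IS its named statement -/

/-- `SomeSLELaw` is the stub S0b, verbatim. -/
theorem someSLELaw_holds : SomeSLELaw := stub_someSLELaw

/-- `SimpleSubseqLimits` (the route decl of stmt-4982) is the stub S1, verbatim. -/
theorem simpleSubseqLimits_holds : SimpleSubseqLimits := stub_simpleSubseqLimits

/-- `SLEFourTraceRemovable` is the stub T3, verbatim. -/
theorem sleFourTraceRemovable_holds : SLEFourTraceRemovable := stub_sleFourTraceRemovable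

/-- `SLEFourDomainTransfer` is the stub T5, verbatim. -/
theorem sleFourDomainTransfer_holds : SLEFourDomainTransfer := stub_sleFourDomainTransfer

/-- `KappaPin` is the stub T4, verbatim. -/
theorem kappaPin_holds : KappaPin := stub_kappaPin

/-! ### Registered names of the stub statements

The skeleton audit admits as hypotheses of `RemovableLimit_of` only propositions whose head
constant is NAMED like a declared stub, so each statement gets a reducible alias carrying its
stub's name. -/
namespace Registered

/-- `SomeSLELaw`, under the name of its stub. -/
abbrev stub_someSLELaw : Prop := SomeSLELaw
/-- `SimpleSubseqLimits` (stmt-4982's decl), under the name of its stub. -/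
abbrev stub_simpleSubseqLimits : Prop := SimpleSubseqLimits
/-- `SLEFourTraceRemovable` (KMS 2022 Thm 1.1), under the name of its stub. -/
abbrev stub_sleFourTraceRemovable : Prop := SLEFourTraceRemovable
/-- `SLEFourDomainTransfer`, under the name of its stub. -/
abbrev stub_sleFourDomainTransfer : Prop := SLEFourDomainTransfer
/-- `KappaPin`, under the name of its stub. -/
abbrev stub_kappaPin : Prop := KappaPin

end Registered

/-! ### Proved rungs -/

/-- **S0b follows from the v4 stub S0a** (drop `κ ≠ 4`). [folklore] -/
theorem someSLELaw_of_sleSubseqLimitUpToKappa (h : SLESubseqLimitUpToKappa) : SomeSLELaw := by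
  intro Q a b hab P hP δs hpos hδ hlim
  obtain ⟨κ, hκ0, -, hSLE⟩ := h Q a b hab P hP δs hpos hδ hlim
  exact ⟨κ, hκ0, hSLE⟩

/-- **S0a follows from the v3 stub S0** (`κ = 8/3 ≠ 4`). [folklore] -/
theorem sleSubseqLimitUpToKappa_of_sleSubseqLimit (h : SLESubseqLimit) : SLESubseqLimitUpToKappa := by
  intro Q a b hab P hP δs hpos hδ hlim
  refine ⟨(8 : ℝ≥0) / 3, by positivity, ?_, h Q a b hab P hP δs hpos hδ hlim⟩
  rw [Ne, div_eq_iff (by norm_num : (3 : ℝ≥0) ≠ 0)]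
  norm_num

/-- **S0 (hence S0a, S0b) follows from the shared crux `SubseqIdentification`** (stmt-0783):
specialise the Dobrushin domain to `Q.chord 0 2`; `δ_n > 0`, `δ_n → 0` is `δ_n → 0⁺`. [folklore] -/
theorem sleSubseqLimit_of_subseqIdentification (h : SubseqIdentification) : SLESubseqLimit := by
  intro Q a b hab P hP δs hpos hδ hlim
  have hδ' : Tendsto δs atTop (𝓝[>] (0 : ℝ)) :=
    tendsto_nhdsWithin_iff.2 ⟨hδ, Eventually.of_forall hpos⟩
  exact h (Q.chord 0 2 (by decide)) a b hab δs P hδ' hP hlim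

/-- **S0 (hence S0a, S0b) follows from this route's crux (W) alone** (tree theorem
`isSLELaw_of_weldingLawOfLimit`, p145305). [folklore] -/
theorem sleSubseqLimit_of_weldingLawOfLimit (hW : WeldingLawOfLimit) : SLESubseqLimit :=
  fun Q a b hab P hP δs hpos hδ hlim =>
    Theorems.RemovableLimit.isSLELaw_of_weldingLawOfLimit hW Q a b hab P hP δs hpos hδ hlim

/-- **S0b follows from the registered dock stub of the stmt-0783 chain**
(`stub_identificationUpToKappa`, quoted verbatim as the hypothesis; tree theorem
`someSLELaw_of_identificationUpToKappa`, p160927). [folklore] -/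
theorem someSLELaw_of_identificationUpToKappa
    (hdock : ∀ (s : ℕ → ℝ), Tendsto s atTop (𝓝[>] (0 : ℝ)) → ∃ κ : ℝ≥0, 0 < κ ∧
      ∀ (D : DobrushinDomain) (a b : ℝ → Site 2), SAW.IsEndpointApprox D a b →
      ∀ (μ : Measure (CurveClass ℂ)), IsProbabilityMeasure μ →
      (∀ f : BoundedContinuousFunction (CurveClass ℂ) ℝ,
        Tendsto (fun n => ∫ γ, f γ.curve ∂(SAW.law D.carrier (s n) (a (s n)) (b (s n)))) atTop
          (𝓝 (∫ x, f x ∂μ))) →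
      IsSLELaw κ D μ) : SomeSLELaw :=
  Theorems.RemovableLimit.someSLELaw_of_identificationUpToKappa hdock

/-- **S1 in the conformal-rectangle framing**: under S1, every subsequential limit in
`(Q; a_δ, b_δ)` is carried by simple chords of `(Q.carrier; Q.pt 0, Q.pt 2)` (tree theorem
`stub_of_simpleSubseqLimits`, p143725). [folklore] -/
theorem ae_isSimpleChord_of_simpleSubseqLimits (h1 : Registered.stub_simpleSubseqLimits)
    (Q : ConformalRectangle) (a b : ℝ → Site 2) (hab : SAW.IsEndpointApprox (Q.chord 0 2 (by decide)) a b)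
    (P : Measure (CurveClass ℂ)) (hP : IsProbabilityMeasure P) (δs : ℕ → ℝ) (hpos : ∀ n, 0 < δs n)
    (hδ : Tendsto δs atTop (𝓝 0))
    (hlim : ∀ f : BoundedContinuousFunction (CurveClass ℂ) ℝ,
      Tendsto (fun n => ∫ γ, f γ.curve ∂(SAW.law Q.carrier (δs n) (a (δs n)) (b (δs n)))) atTop
        (𝓝 (∫ γ, f γ ∂P))) :
    ∀ᵐ γ ∂P, IsSimpleChord Q γ :=
  Theorems.RemovableLimit.stub_of_simpleSubseqLimits h1 Q a b hab P hP δs hpos hδ hlim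

/-- **T3 ⟹ SLE₄ curves in a Dobrushin domain have a.s. removable trace inside the domain** (= T5
applied to T3; tree theorem `Theorems.RemovableLimit.stub_sleFourDomainTransfer`, p164908, built on the
deterministic transfer `isConformallyRemovableIn_range_of_isCompactifiedImage_of_trace`). [folklore] -/
theorem ae_isConformallyRemovableIn_range_of_isSLECurve_four
    (h3 : Registered.stub_sleFourTraceRemovable)
    {D : DobrushinDomain} {Γ : (ℝ≥0 → ℝ) → CurveClass ℂ} (hΓ : IsSLECurve 4 D Γ) :
    ∀ᵐ ω ∂preWienerMeasure, IsConformallyRemovableIn D.carrier (Γ ω).range :=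
  Theorems.RemovableLimit.stub_sleFourDomainTransfer h3 D Γ hΓ

/-- **T3 ⟹ every simple-phase SLE law (`0 < κ ≤ 4`) is carried by removable curves** (tree theorem
`ae_isConformallyRemovableIn_of_isSLELaw_of_le_four_of_trace`, p164908). [folklore] -/
theorem ae_isConformallyRemovableIn_of_isSLELaw_of_le_four (h3 : Registered.stub_sleFourTraceRemovable)
    {κ : ℝ≥0} (h0 : 0 < κ) (h4 : κ ≤ 4) {D : DobrushinDomain} {P : Measure (CurveClass ℂ)}
    (h : IsSLELaw κ D P) : ∀ᵐ γ ∂P, IsConformallyRemovableIn D.carrier γ.range :=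
  Theorems.RemovableLimit.ae_isConformallyRemovableIn_of_isSLELaw_of_le_four_of_trace h3 h0 h4 h

/-! ### The skeleton theorem: the stubs imply the crux, BY NAME -/

/-- **`RemovableLimit` from the line `birth` (v5)** (kernel-checked, no `sorry` of its own): S1
gives the simple-chord half of the crux and `P`-a.e. simplicity; S0b makes `P` an SLE_κ law in
`Q.chord 0 2` with `0 < κ`; the landed pin T4 gives `κ ≤ 4`; for `κ < 4` the landed transfer
(RS05 Thm 5.2 + Jones–Smirnov) and for `κ = 4` the literature stub T3 (Kavvadias–Miller–Schoug,
through `ae_isConformallyRemovableIn_range_of_isSLECurve_four` and the analytic bad set) give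
`P`-a.e. removability, delivered in the self-map clause of the crux. Hypotheses = the three open
stubs under their registered names; conclusion = the route decl
`Summit.CriticalPhenomena.SAWScalingLimit.Theses.SAWWeldingIdentification.RemovableLimit`. -/
theorem RemovableLimit_of (h0b : Registered.stub_someSLELaw)
    (h1 : Registered.stub_simpleSubseqLimits) (h3 : Registered.stub_sleFourTraceRemovable) :
    RemovableLimit :=
  -- T4 `stub_kappaPin` (p160927) and T5 `stub_sleFourDomainTransfer` (p164908) are LANDED and used
  -- inside the tree composition
  Theorems.RemovableLimit.removableLimit_of_someSLELaw_of_simpleSubseqLimits_of_trace h3 h0b h1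

/-- The same composition with T4 and T5 as explicit (registered, landed) hypotheses — kept to show
where the pin and the transfer enter. -/
theorem RemovableLimit_of' (h0b : Registered.stub_someSLELaw)
    (h1 : Registered.stub_simpleSubseqLimits) (h3 : Registered.stub_sleFourTraceRemovable)
    (hpin : Registered.stub_kappaPin) (h5 : Registered.stub_sleFourDomainTransfer) : RemovableLimit := by
  intro Q a b hab P hP δs hpos hδ hlim
  have hsc := ae_isSimpleChord_of_simpleSubseqLimits h1 Q a b hab P hP δs hpos hδ hlim
  obtain ⟨κ, hκ0, hSLE⟩ := h0b Q a b hab P hP δs hpos hδ hlim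
  have hle : κ ≤ 4 := hpin κ _ P hSLE (hsc.mono fun γ hγ => hγ.1)
  have hrem : ∀ᵐ γ ∂P, IsConformallyRemovableIn (Q.chord 0 2 (by decide)).carrier γ.range := by
    rcases hle.lt_or_eq with hlt | heq
    · exact Theorems.RemovableLimit.ae_isConformallyRemovableIn_of_isSLELaw hκ0 hlt hSLE
    · subst heq
      exact Theorems.RemovableLimit.ae_isConformallyRemovableIn_of_isSLELaw_four (h5 h3) hSLE
  filter_upwards [hsc, hrem] with γ h1γ h2γ
  exact ⟨h1γ, h2γ.self_maps⟩

/-- **Wiring check**: the stubs AS STATED feed the skeleton theorem (this term becomes the crux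
proof once the open `sorry`s S0b, S1, T3 are discharged). -/
example : RemovableLimit :=
  RemovableLimit_of stub_someSLELaw stub_simpleSubseqLimits stub_sleFourTraceRemovable

/-- **Wiring check (v5 refines v4)**: the v4 stubs S0a ∧ S1 still give the crux WITHOUT T3 (tree:
`removableLimit_of_upToKappa_of_simpleSubseqLimits`, p160927), and S0a gives S0b. -/
example (h0a : SLESubseqLimitUpToKappa) : RemovableLimit :=
  Theorems.RemovableLimit.removableLimit_of_upToKappa_of_simpleSubseqLimits h0a stub_simpleSubseqLimits

/-- **Wiring check (named-fact form)**: the crux modulo the Literature named fact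
`KavvadiasMillerSchoug2022_thm11` and the two research stubs S0b, S1 (tree:
`removableLimit_of_someSLELaw_of_simpleSubseqLimits_of_trace`, p164908). -/
example (hK : Literature.Probability.RandomPlanarGeometry.KavvadiasMillerSchoug2022_thm11) :
    RemovableLimit :=
  RemovableLimit_of stub_someSLELaw stub_simpleSubseqLimits (stub_sleFourTraceRemovable_of_kms hK)

/-- **Wiring check (shared currency)**: the stmt-0783 dock stub, S1 and T3 give the crux. -/
example
    (hdock : ∀ (s : ℕ → ℝ), Tendsto s atTop (𝓝[>] (0 : ℝ)) → ∃ κ : ℝ≥0, 0 < κ ∧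
      ∀ (D : DobrushinDomain) (a b : ℝ → Site 2), SAW.IsEndpointApprox D a b →
      ∀ (μ : Measure (CurveClass ℂ)), IsProbabilityMeasure μ →
      (∀ f : BoundedContinuousFunction (CurveClass ℂ) ℝ,
        Tendsto (fun n => ∫ γ, f γ.curve ∂(SAW.law D.carrier (s n) (a (s n)) (b (s n)))) atTop
          (𝓝 (∫ x, f x ∂μ))) →
      IsSLELaw κ D μ) : RemovableLimit :=
  RemovableLimit_of (someSLELaw_of_identificationUpToKappa hdock) stub_simpleSubseqLimits
    stub_sleFourTraceRemovable

/-- **Wiring check ((R) ⟸ (W))**, unchanged from v3 (tree: `removableLimit_of_weldingLawOfLimit`,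
p151121): the crux follows from this route's crux `WeldingLawOfLimit` (stmt-4502) alone. -/
example (hW : WeldingLawOfLimit) : RemovableLimit :=
  Theorems.RemovableLimit.removableLimit_of_weldingLawOfLimit hW

/-- **Wiring check ((R) ⟸ stmt-0783)** (tree: `removableLimit_of_subseqIdentification`). -/
example (hI : SubseqIdentification) : RemovableLimit :=
  Theorems.RemovableLimit.removableLimit_of_subseqIdentification hI

/-- **Wiring check (honesty: (R) ⟸ summit)** (tree: `removableLimit_of_sawScalingLimit`). -/
example (hS : _root_.SAWScalingLimit) : RemovableLimit :=
  Theorems.RemovableLimit.removableLimit_of_sawScalingLimit hS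

/-- **Wiring check (necessity of S1)**: the crux implies S1 (tree:
`simpleSubseqLimits_of_removableLimit`, p143725), so S1 costs the line nothing. -/
example (hR : RemovableLimit) : SimpleSubseqLimits :=
  Theorems.RemovableLimit.simpleSubseqLimits_of_removableLimit hR

end Summit.CriticalPhenomena.SAWScalingLimit.Cruxes.RemovableLimit.Birth

end
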